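import Summits.Ventures.AbcSig.Recipes.KrausTable
import Summits.Ventures.AbcSig.Recipes.EisPackage

/-!
# Venture AbcSig — the Frey trace of a datum, SOUNDNESS of the Kraus tables for actual solutions, and the trace package

HONEST FRAMING. Interface + elementary-arithmetic file of the COMPUTATION cell `pub-abcsig`. No Diophantine equation is solved here
and nothing is a claim on ABC or any summit. ONE new named hypothesis (`NewformModel.FreyTracePackage`, CITED, the primitive form of
the trace congruences already assumed by `BS04Package` clause (2) and by `RefinedTraces`); everything else is PROVED.

WHAT IS HERE.
* `freyTrace μ S q` — the naive trace of Frobenius at the prime `q` of the Frey curve `E_μ(a, b, c)` of a datum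
  `S = (A, B, C, n, a, b, c)` ([BS04, p. 27] models `E₁, E₂, E₃`; `E₃` in its completed-square form), computed by the generator's
  `traceNaive` on the reduced coefficients `μ.coeffs` (`Recipes/KrausTable.lean`). Same formula as the `freyTrace` of the cell's
  `CONJ_LR32_L2″` draft (HOME/plean/g7/CONJ-LR32-L2-DRAFT-g7.md), so that draft can import it.
* **`freyTrace_mem_krausTable` (PROVED)** — SOUNDNESS of the computable Kraus table with respect to ACTUAL solutions: if
  `A aⁿ + B bⁿ = C c²` and the prime `q` divides none of `A, a, b`, then `freyTrace μ S q ∈ krausTable μ A B C n q`. Reason: the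
  generator enumerates `u ∈ (𝔽_q^×)ⁿ`, `c ∈ 𝔽_q` with `(C c² − B u)/A ∈ (𝔽_q^×)ⁿ`; the datum's own residues `u = bⁿ`, `c` qualify, with
  `(C c² − B bⁿ)/A = aⁿ` (`krausKept_eq_pow`, Fermat inverse `invModP`). This is the elementary half of Kraus's auxiliary-prime method
  [Kra97; BS04, Prop. 4.3] — the half that `Recipes/KrausTable.lean` explicitly left open ("What this file does NOT do").
* `dvd_bs04OddLevel_of_dvd`, `dvd_bs04Level_of_dvd` (PROVED) — every odd prime `q ≠ n` of `ABC` divides the odd part `bs04OddLevel A B C n`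
  of the Serre level [BS04, Lemma 3.2] (and hence the level of every case), so at an odd prime `q ∤ N`, `bs04OddLevel ∣ N`, the Frey
  curve has good (`q ∤ ab`) or multiplicative (`q ∣ ab`) reduction.
* `NewformModel.FreyTracePackage` — **NAMED HYPOTHESIS (CITED)**, see its docstring: [BS04, (3.1) p. 31] + the curves of
  [Lemma 2.1 / p. 27] + the proof of [Lemma 4.2, p. 33]: `Arises S N f` for a standing datum in case `κ` and a level `N` divisible
  by the odd part `bs04OddLevel A B C n` of the Serre level (so at [BS04]'s level, and at the odd level of the erratum-E3 sub-class)
  gives a reduction map `ψ` (characteristic `n`) with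
  `ψ(c_q) = ±(q + 1)` at odd primes `q ∣ ab` and `ψ(c_q) = freyTrace κ.model S q` at odd primes `q ∤ ab` (`q ≠ n`, `q ∤ N`).
* `FreyTracePackage.exists_psi_mem_krausTable` (PROVED) — hence `ψ(c_q)` is an entry of the Kraus table at EVERY odd prime `q ≠ n`,
  `q ∤ N` (for `N` divisible by `bs04OddLevel`): the exponent-specific tables of the cell's module M4 and
  single-exponent rows (`RefinedTraces`, `Rows/TemplateKraus.lean`; `krausAllowed_C7_*`, `krausTab_*`, reproduced by `krausTable` in
  `Recipes/KrausTableCheck.lean`) are, for standing data, CONSEQUENCES of the trace package — no longer a separately COMPUTED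
  hypothesis. The complementary statement at non-auxiliary primes (`ψ(c_q) ∈ bs04Allowed q`, i.e. [BS04, Lemma 4.2]) needs Hasse's
  theorem and is proved in `Recipes/FreyTraceLemma42.lean`.

References: [BS04] M. A. Bennett, C. M. Skinner, *Ternary Diophantine equations via Galois representations and modular forms*,
Canad. J. Math. 56 (2004) 23–54: p. 27 (curves `E₁, E₂, E₃`), Lemma 2.1, (3.1) p. 31, Lemma 3.2, Lemma 4.2 (p. 33), Prop. 4.3;
A. Kraus, *Majorations effectives pour l'équation de Fermat généralisée*, Canad. J. Math. 49 (1997) 1139–1161; cell records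
HOME/lit/BennettSkinner2004-asprinted.md §2–§4 (statements AS PRINTED), HOME/referee/refallowed.py (the generator transcribed by
`Recipes/KrausTable.lean`).
-/

namespace Summit.Ventures.AbcSig

/-! ## The naive trace of the Frey curve of a datum -/

/-- **The trace of Frobenius of the Frey curve of a datum, computed naively.** For `S = (A, B, C, n, a, b, c)`, a model
`μ ∈ {E₁, E₂, E₃}` and an odd prime `q`: reduce `u = bⁿ` and `c` modulo `q`, form the coefficients `(a₂, a₄)` of
`μ.coeffs` ([BS04, p. 27]: `E₁ : Y² = X³ + 2cC·X² + BC bⁿ·X`, `E₂ : Y² = X³ + cC·X² + (BC bⁿ/4)·X`, and for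
`E₃ : Y² + XY = X³ + ((cC − 1)/4)·X² + (BC bⁿ/64)·X` the model `Y² = X³ + (cC/4)·X² + (BC bⁿ/64)·X` obtained by completing
the square `Y ↦ Y − X/2`, isomorphic to `E₃` over `𝔽_q` for odd `q`), and return `traceNaive q a₂ a₄ = −Σ_{x mod q} χ_q(x³ + a₂x² + a₄x)`
(`Recipes/KrausTable.lean`). When `q ∤ 2ABC·ab` the reduced curve is elliptic and this integer is `q + 1 − #E_μ(S)(𝔽_q)`, the
trace of Frobenius `a_q(E_μ(a, b, c))`. Same formula as `freyTrace` of the cell's `CONJ_LR32_L2″` draft (HOME/plean/g7). -/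
def freyTrace (μ : FreyModel) (S : FreyDatum) (q : ℕ) : ℤ :=
  let u : ℕ := Int.toNat ((S.b ^ S.n) % (q : ℤ))
  let c : ℕ := Int.toNat (S.c % (q : ℤ))
  let p := μ.coeffs q S.B S.C u c
  traceNaive q p.1 p.2

/-! ## Bookkeeping: residues of integers as natural numbers, read in `ZMod q` -/

/-- For `q ≠ 0`, the natural number `(z mod q).toNat` is `< q`. -/
theorem toNat_emod_lt (z : ℤ) {q : ℕ} (hq : q ≠ 0) : Int.toNat (z % (q : ℤ)) < q := by
  have h0 : 0 ≤ z % (q : ℤ) := Int.emod_nonneg z (by exact_mod_cast hq)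
  have h1 : z % (q : ℤ) < (q : ℤ) := Int.emod_lt_of_pos z (by exact_mod_cast Nat.pos_of_ne_zero hq)
  have h2 : ((Int.toNat (z % (q : ℤ)) : ℕ) : ℤ) = z % (q : ℤ) := Int.toNat_of_nonneg h0
  omega

/-- For `q ≠ 0`, the residue `(z mod q).toNat` represents `z` in `ZMod q`. -/
theorem natCast_toNat_emod (z : ℤ) {q : ℕ} (hq : q ≠ 0) : ((Int.toNat (z % (q : ℤ)) : ℕ) : ZMod q) = (z : ZMod q) := by
  have h0 : 0 ≤ z % (q : ℤ) := Int.emod_nonneg z (by exact_mod_cast hq)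
  rw [← Int.cast_natCast, Int.toNat_of_nonneg h0, ZMod.intCast_mod]

/-- `(zⁿ mod q).toNat` is one of the generator's nonzero `n`-th power residues when the prime `q` does not divide `z`. -/
theorem toNat_pow_emod_mem_nthPowerResidues {q : ℕ} (hq : q.Prime) (n : ℕ) {z : ℤ} (hz : ¬ (q : ℤ) ∣ z) :
    Int.toNat ((z ^ n) % (q : ℤ)) ∈ nthPowerResidues q n := by
  have hq0 : q ≠ 0 := hq.ne_zero
  haveI : Fact q.Prime := ⟨hq⟩
  unfold nthPowerResidues
  rw [List.mem_dedup, List.mem_map]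
  refine ⟨Int.toNat (z % (q : ℤ)), ?_, ?_⟩
  · rw [List.mem_filter, List.mem_range]
    refine ⟨toNat_emod_lt z hq0, ?_⟩
    have hne : Int.toNat (z % (q : ℤ)) ≠ 0 := by
      intro h0
      apply hz
      have hcast := natCast_toNat_emod z hq0
      rw [h0, Nat.cast_zero] at hcast
      exact (ZMod.intCast_zmod_eq_zero_iff_dvd z q).mp hcast.symm
    simpa using hne
  · -- naturals `< q` with equal images in `ZMod q` are equal (folklore; in the tree as
    -- `Literature.Combinatorics.Extremal.natCast_zmod_eq_of_lt`, inlined here to keep the imports topical)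
    have key : ∀ {a b : ℕ}, a < q → b < q → (a : ZMod q) = (b : ZMod q) → a = b := fun ha hb h => by
      have := (ZMod.natCast_eq_natCast_iff' _ _ q).mp h
      rwa [Nat.mod_eq_of_lt ha, Nat.mod_eq_of_lt hb] at this
    apply key (Nat.mod_lt _ (Nat.pos_of_ne_zero hq0)) (toNat_emod_lt _ hq0)
    rw [ZMod.natCast_mod, Nat.cast_pow, natCast_toNat_emod z hq0, natCast_toNat_emod (z ^ n) hq0, Int.cast_pow]

/-- Membership in `insertSorted` (only the direction used here; cf. the cell's `Conjectures/KrausTableRefines.lean`). -/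
private theorem mem_insertSorted_of_mem_or {x t : ℤ} {l : List ℤ} (h : x = t ∨ x ∈ l) : x ∈ insertSorted t l := by
  induction l with
  | nil =>
    rcases h with rfl | h
    · simp [insertSorted]
    · simp at h
  | cons s rest ih =>
    simp only [insertSorted]
    split_ifs with h1 h2
    · simpa using h
    · subst h2; simpa using h
    · rcases h with rfl | h
      · exact List.mem_cons_of_mem _ (ih (Or.inl rfl))
      · rcases List.mem_cons.mp h with rfl | h
        · exact List.mem_cons_self
        · exact List.mem_cons_of_mem _ (ih (Or.inr h))

/-- Membership in an `insertSorted` fold (direction used here). -/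
private theorem mem_foldl_insertSorted_of {x : ℤ} (l acc : List ℤ) (h : x ∈ l ∨ x ∈ acc) :
    x ∈ l.foldl (fun acc t => insertSorted t acc) acc := by
  induction l generalizing acc with
  | nil => simpa using h
  | cons t rest ih =>
    simp only [List.foldl_cons]
    apply ih
    rcases h with h | h
    · rcases List.mem_cons.mp h with rfl | h
      · exact Or.inr (mem_insertSorted_of_mem_or (Or.inl rfl))
      · exact Or.inl h
    · exact Or.inr (mem_insertSorted_of_mem_or (Or.inr h))

/-- `±(q + 1)` are entries of every Kraus table (the traces at primes of multiplicative reduction, [BS04, Lemma 4.2]). -/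
theorem neg_mem_krausTable (μ : FreyModel) (A B C n q : ℕ) : -((q : ℤ) + 1) ∈ krausTable μ A B C n q := by
  unfold krausTable
  exact mem_foldl_insertSorted_of _ _ (Or.inr (by simp))

/-- `±(q + 1)` are entries of every Kraus table (the traces at primes of multiplicative reduction, [BS04, Lemma 4.2]). -/
theorem pos_mem_krausTable (μ : FreyModel) (A B C n q : ℕ) : (q : ℤ) + 1 ∈ krausTable μ A B C n q := by
  unfold krausTable
  exact mem_foldl_insertSorted_of _ _ (Or.inr (by simp))

/-! ## Soundness of the Kraus table with respect to actual solutions -/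

/-- **The generator's "`aⁿ`" at the datum's own residues is `aⁿ`.** For `A aⁿ + B bⁿ = C c²` and a prime `q ∤ A`, the
residue `(C c² − B u)·A⁻¹ mod q` formed by `krausTable` at `u = bⁿ mod q`, `c mod q` equals `aⁿ` in `ZMod q`. -/
theorem krausKept_eq_pow (S : FreyDatum) {q : ℕ} (hq : q.Prime)
    (heq : (S.A : ℤ) * S.a ^ S.n + S.B * S.b ^ S.n = S.C * S.c ^ 2) (hA : ¬ (q : ℤ) ∣ S.A) :
    (((S.C * Int.toNat (S.c % (q : ℤ)) * Int.toNat (S.c % (q : ℤ)) % q + q -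
        S.B * Int.toNat ((S.b ^ S.n) % (q : ℤ)) % q) % q * invModP q S.A % q : ℕ) : ZMod q) =
      ((S.a : ZMod q)) ^ S.n := by
  haveI : Fact q.Prime := ⟨hq⟩
  have hq0 : q ≠ 0 := hq.ne_zero
  have hA' : ((S.A : ℕ) : ZMod q) ≠ 0 := by
    intro h
    apply hA
    have : ((S.A : ℤ) : ZMod q) = 0 := by exact_mod_cast h
    exact (ZMod.intCast_zmod_eq_zero_iff_dvd _ q).mp this
  have heqZ : (S.A : ZMod q) * (S.a : ZMod q) ^ S.n + (S.B : ZMod q) * (S.b : ZMod q) ^ S.n =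
      (S.C : ZMod q) * (S.c : ZMod q) ^ 2 := by
    have := congrArg (fun z : ℤ => (z : ZMod q)) heq
    push_cast at this
    exact this
  -- the residue `(C c₀² − B u) mod q`, computed in `ℕ` as the generator does, read in `ZMod q`
  have hres : ∀ B C u c : ℕ,
      (((C * c * c % q + q - B * u % q) % q : ℕ) : ZMod q) = (C : ZMod q) * c * c - (B : ZMod q) * u := by
    intro B C u c
    have hle : B * u % q ≤ C * c * c % q + q := le_add_left (Nat.mod_lt _ (Nat.pos_of_ne_zero hq0)).le
    rw [ZMod.natCast_mod, Nat.cast_sub hle]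
    push_cast
    rw [ZMod.natCast_mod, ZMod.natCast_self, ZMod.natCast_mod]
    push_cast
    ring
  -- Fermat: `A · A^(q-2) = A^(q-1) = 1` in `ZMod q`
  have hinv : ((S.A : ℕ) : ZMod q) * (invModP q S.A : ℕ) = 1 := by
    unfold invModP
    rw [ZMod.natCast_mod, Nat.cast_pow, ← pow_succ', show q - 2 + 1 = q - 1 from by have := hq.two_le; omega]
    exact ZMod.pow_card_sub_one_eq_one hA'
  rw [ZMod.natCast_mod, Nat.cast_mul, hres, natCast_toNat_emod _ hq0, natCast_toNat_emod _ hq0, Int.cast_pow]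
  have hsub : (S.C : ZMod q) * (S.c : ZMod q) * (S.c : ZMod q) - (S.B : ZMod q) * (S.b : ZMod q) ^ S.n =
      (S.A : ZMod q) * (S.a : ZMod q) ^ S.n := by
    linear_combination (-1 : ZMod q) * heqZ
  rw [hsub, mul_comm ((S.A : ℕ) : ZMod q), mul_assoc, hinv, mul_one]

/-- … and it is NONZERO when moreover `q ∤ a` (so the generator KEEPS the pair `(bⁿ mod q, c mod q)`). -/
theorem krausKept_ne_zero (S : FreyDatum) {q : ℕ} (hq : q.Prime)
    (heq : (S.A : ℤ) * S.a ^ S.n + S.B * S.b ^ S.n = S.C * S.c ^ 2) (hA : ¬ (q : ℤ) ∣ S.A) (ha : ¬ (q : ℤ) ∣ S.a) :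
    (S.C * Int.toNat (S.c % (q : ℤ)) * Int.toNat (S.c % (q : ℤ)) % q + q -
        S.B * Int.toNat ((S.b ^ S.n) % (q : ℤ)) % q) % q * invModP q S.A % q ≠ 0 := by
  haveI : Fact q.Prime := ⟨hq⟩
  intro h0
  have hcast := krausKept_eq_pow S hq heq hA
  rw [h0, Nat.cast_zero] at hcast
  have ha' : (S.a : ZMod q) ≠ 0 := fun h => ha ((ZMod.intCast_zmod_eq_zero_iff_dvd _ q).mp h)
  exact pow_ne_zero _ ha' hcast.symm

/-- **SOUNDNESS OF THE KRAUS TABLE (the elementary half of Kraus's auxiliary-prime method [Kra97; BS04, Prop. 4.3]).**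
If `A aⁿ + B bⁿ = C c²` and the prime `q` divides none of `A`, `a`, `b`, then the naive trace `freyTrace μ S q` of the Frey
curve `E_μ(a, b, c)` over `𝔽_q` is an entry of `krausTable μ A B C n q`: `u = bⁿ` and `aⁿ = (C c² − B u)/A` are nonzero
`n`-th power residues modulo `q`, so the generator enumerates exactly this curve. Pure bookkeeping — no parity, size or
primality condition on the datum beyond `q ∤ A·a·b`. -/
theorem freyTrace_mem_krausTable (μ : FreyModel) (S : FreyDatum) {q : ℕ} (hq : q.Prime)
    (heq : (S.A : ℤ) * S.a ^ S.n + S.B * S.b ^ S.n = S.C * S.c ^ 2)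
    (hA : ¬ (q : ℤ) ∣ S.A) (ha : ¬ (q : ℤ) ∣ S.a) (hb : ¬ (q : ℤ) ∣ S.b) :
    freyTrace μ S q ∈ krausTable μ S.A S.B S.C S.n q := by
  haveI : Fact q.Prime := ⟨hq⟩
  have hq0 : q ≠ 0 := hq.ne_zero
  set u : ℕ := Int.toNat ((S.b ^ S.n) % (q : ℤ)) with hu
  set c₀ : ℕ := Int.toNat (S.c % (q : ℤ)) with hc₀
  set an : ℕ := (S.C * c₀ * c₀ % q + q - S.B * u % q) % q * invModP q S.A % q with han
  -- the generator's `aⁿ` is `aⁿ`, hence a nonzero `n`-th power residue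
  have han_cast : ((an : ℕ) : ZMod q) = (S.a : ZMod q) ^ S.n := krausKept_eq_pow S hq heq hA
  have han0 : an ≠ 0 := krausKept_ne_zero S hq heq hA ha
  have hanU : an ∈ nthPowerResidues q S.n := by
    have hmem := toNat_pow_emod_mem_nthPowerResidues hq S.n ha
    have heqn : Int.toNat ((S.a ^ S.n) % (q : ℤ)) = an := by
      have key : ∀ {a b : ℕ}, a < q → b < q → (a : ZMod q) = (b : ZMod q) → a = b := fun ha hb h => by
        have := (ZMod.natCast_eq_natCast_iff' _ _ q).mp h
        rwa [Nat.mod_eq_of_lt ha, Nat.mod_eq_of_lt hb] at this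
      apply key (toNat_emod_lt _ hq0) (Nat.mod_lt _ (Nat.pos_of_ne_zero hq0))
      rw [natCast_toNat_emod _ hq0, Int.cast_pow, han_cast]
    rwa [heqn] at hmem
  have huU : u ∈ nthPowerResidues q S.n := toNat_pow_emod_mem_nthPowerResidues hq S.n hb
  have hc₀q : c₀ < q := toNat_emod_lt _ hq0
  -- unfold the table and exhibit the entry
  show freyTrace μ S q ∈ krausTable μ S.A S.B S.C S.n q
  unfold krausTable
  apply mem_foldl_insertSorted_of
  left
  rw [List.mem_flatMap]
  refine ⟨u, huU, ?_⟩
  rw [List.mem_filterMap]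
  refine ⟨c₀, List.mem_range.mpr hc₀q, ?_⟩
  have hcond : an ≠ 0 ∧ an ∈ nthPowerResidues q S.n := ⟨han0, hanU⟩
  simp only [← han]
  rw [if_pos hcond]
  rfl

/-- Under a prime `q ∤ A·a·b`, a value that is `±(q + 1)` when `q ∣ ab` and the naive Frey trace when `q ∤ ab` is (the image
of) an entry of the Kraus table — the form in which the trace package below is consumed. -/
theorem exists_mem_krausTable_of_trace (μ : FreyModel) (S : FreyDatum) {q : ℕ} (hq : q.Prime)
    (heq : (S.A : ℤ) * S.a ^ S.n + S.B * S.b ^ S.n = S.C * S.c ^ 2) (hA : ¬ (q : ℤ) ∣ S.A)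
    {k : Type} [Field k] {x : k}
    (hmult : (q : ℤ) ∣ S.a * S.b → x = (((q : ℤ) + 1 : ℤ) : k) ∨ x = ((-((q : ℤ) + 1) : ℤ) : k))
    (hgood : ¬ (q : ℤ) ∣ S.a * S.b → x = ((freyTrace μ S q : ℤ) : k)) :
    ∃ t ∈ krausTable μ S.A S.B S.C S.n q, x = (t : k) := by
  by_cases hab : (q : ℤ) ∣ S.a * S.b
  · rcases hmult hab with h | h
    · exact ⟨_, pos_mem_krausTable μ S.A S.B S.C S.n q, h⟩
    · exact ⟨_, neg_mem_krausTable μ S.A S.B S.C S.n q, h⟩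
  · have ha : ¬ (q : ℤ) ∣ S.a := fun h => hab (h.mul_right _)
    have hb : ¬ (q : ℤ) ∣ S.b := fun h => hab (h.mul_left _)
    exact ⟨_, freyTrace_mem_krausTable μ S hq heq hA ha hb, hgood hab⟩

/-! ## Odd primes of `ABC` divide the odd part of the Serre level -/

/-- Every odd prime `q ≠ n` dividing `ABC` divides the ODD PART `bs04OddLevel A B C n = ∏_{p ∣ C, p odd, p ≠ n} p² ·
∏_{q ∣ AB, q odd, q ≠ n} q` of the Serre level [BS04, Lemma 3.2]. Used to see that at an odd prime `q ∤ N` (for a level `N`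
divisible by that odd part) the Frey curve has good (`q ∤ ab`) or multiplicative (`q ∣ ab`) reduction. -/
theorem dvd_bs04OddLevel_of_dvd {A B C n q : ℕ} (hq : q.Prime) (hq2 : q ≠ 2) (hqn : q ≠ n) (hA : 0 < A) (hB : 0 < B)
    (hC : 0 < C) (h : q ∣ A * B * C) : q ∣ bs04OddLevel A B C n := by
  unfold bs04OddLevel
  rcases (Nat.Prime.dvd_mul hq).mp h with hAB | hC'
  · apply Dvd.dvd.mul_left
    have hmem : q ∈ (A * B).primeFactors.filter (fun q => q ≠ 2 ∧ q ≠ n) := by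
      rw [Finset.mem_filter, Nat.mem_primeFactors]
      exact ⟨⟨hq, hAB, Nat.pos_iff_ne_zero.mp (Nat.mul_pos hA hB)⟩, hq2, hqn⟩
    exact Finset.dvd_prod_of_mem (fun q => q) hmem
  · apply Dvd.dvd.mul_right
    have hmem : q ∈ C.primeFactors.filter (fun p => p ≠ 2 ∧ p ≠ n) := by
      rw [Finset.mem_filter, Nat.mem_primeFactors]
      exact ⟨⟨hq, hC', Nat.pos_iff_ne_zero.mp hC⟩, hq2, hqn⟩
    exact (dvd_pow_self q two_ne_zero).trans (Finset.dvd_prod_of_mem (fun p => p ^ 2) hmem)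

/-- The odd part divides the Serre level of every case. -/
theorem bs04OddLevel_dvd_bs04Level (κ : FreyCase) (A B C n : ℕ) : bs04OddLevel A B C n ∣ bs04Level κ A B C n :=
  Dvd.intro_left _ rfl

/-- Every odd prime `q ≠ n` dividing `ABC` divides the Serre level `bs04Level κ A B C n` [BS04, Lemma 3.2]. -/
theorem dvd_bs04Level_of_dvd (κ : FreyCase) {A B C n q : ℕ} (hq : q.Prime) (hq2 : q ≠ 2) (hqn : q ≠ n)
    (hA : 0 < A) (hB : 0 < B) (hC : 0 < C) (h : q ∣ A * B * C) : q ∣ bs04Level κ A B C n :=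
  (dvd_bs04OddLevel_of_dvd hq hq2 hqn hA hB hC h).trans (bs04OddLevel_dvd_bs04Level κ A B C n)

/-! ## The named hypothesis: congruence of `f` with the Frey curve, prime by prime -/

/-- **NAMED HYPOTHESIS (CITED) — the trace package [BS04, (3.1) p. 31 + Lemma 2.1/p. 27 + proof of Lemma 4.2 p. 33].**
Printed inputs. (a) The curves (p. 27): "`E₁(a,b,c): Y² = X³ + 2cC X² + BC bⁿ X`" (cases (i), (ii)), "`E₂(a,b,c):
Y² = X³ + cC X² + (BC bⁿ/4) X`" (cases (iii), (iv)), "`E₃(a,b,c): Y² + XY = X³ + ((cC − 1)/4) X² + (BC bⁿ/64) X`" (case (v));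
Lemma 2.1: "`Δ(E_i(a,b,c)) = 2^{δ_i} C³ B² A (a b²)ⁿ`", "In particular, `E` has multiplicative reduction at each odd prime `p`
dividing `abAB`". (b) (3.1), p. 31: if `ρ^E_n` arises from the newform `f` of level `M` then "`trace ρ_{f,ν}(Frob_p) ≡ c_p (mod ν)`
for all `p` not dividing `Mn`". (c) Proof of Lemma 4.2, p. 33: for an odd prime `p ∤ n N^E_n`, "`p ∣ ab` ⇒ multiplicative ⇒
`±(1 + p)`; `p ∤ ab` ⇒ `a_p`" (the trace of Frobenius of `E` at a prime of good reduction). (c') p. 33 as summarised in the cell's as-printed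
record HOME/lit/BennettSkinner2004-asprinted.md §4 — the quotation marks in (c) delimit that record's summary, not the paper's sentence.
In the interface: for a STANDING datum `S` in case `κ` (hypotheses of [BS04, Lemma 3.3], see `Standing`) and a newform `f` of a level
`N` DIVISIBLE BY THE ODD PART `bs04OddLevel A B C n` OF THE SERRE LEVEL (this covers [BS04]'s own level `bs04Level κ A B C n`
and the odd level of the cell's erratum-E3 sub-class, `Recipes/E3Package.lean`; for arbitrary levels see `LevelDividesPackage` in
`Recipes/BS04PackageParts.lean`) with `M.Arises S N f`, there is a ring homomorphism `ψ : Coeff f → k` to a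
field of characteristic `n` (reduction modulo the prime `ν ∣ n`) such that for every odd prime `q ≠ n` not dividing `N`: if `q ∣ ab`
then `ψ(c_q) = ±(q + 1)` (multiplicative reduction, `ρ^E_n` unramified at `q`), and if `q ∤ ab` then `ψ(c_q)` is the trace of
Frobenius of `E_κ(a, b, c)` at `q`, i.e. the integer `freyTrace κ.model S q` (good reduction: an odd prime `q ≠ n` with `q ∤ N` is
prime to `ABC` because the odd primes of `ABC` other than `n` divide `bs04OddLevel`, `dvd_bs04OddLevel_of_dvd`; for `E₃` the
completed-square model is used, which is isomorphic over `𝔽_q`). Only ODD primes `q` are concerned (the prime `2` at odd level is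
the business of `Recipes/Q2Package.lean`), so nothing here depends on the `2`-part of the printed level. This is the PRIMITIVE form of the trace congruences: [BS04, Lemma 4.2] (`bs04Allowed`, clause (2) of `BS04Package`) and
Kraus's exponent-specific tables (`RefinedTraces`) are CONSEQUENCES of it — the latter by `exists_mem_krausTable_of_trace` /
`freyTrace_mem_krausTable` in this file, the former by Hasse's bound and the rational `2`-torsion point (`Recipes/FreyTraceLemma42.lean`).
CITED, never proved here; rows may take `(hT : M.FreyTracePackage)`. The printed caveat at `n = 7` (Bennett–Vatsal–Yazdani 2004 on
[BS04, Cor. 3.1]) concerns clause (1) of `BS04Package`, not this package. -/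
def NewformModel.FreyTracePackage (M : NewformModel) : Prop :=
  ∀ (S : FreyDatum) (κ : FreyCase), Standing S κ →
    ∀ (N : ℕ) (f : M.Form N), bs04OddLevel S.A S.B S.C S.n ∣ N → M.Arises S N f →
      ∃ (k : Type) (_ : Field k) (_ : CharP k S.n) (ψ : M.Coeff N f →+* k),
        ∀ q : ℕ, q.Prime → q ≠ 2 → q ≠ S.n → ¬ q ∣ N →
          ((q : ℤ) ∣ S.a * S.b →
              ψ (M.eig N f q) = (((q : ℤ) + 1 : ℤ) : k) ∨ ψ (M.eig N f q) = ((-((q : ℤ) + 1) : ℤ) : k)) ∧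
          (¬ (q : ℤ) ∣ S.a * S.b → ψ (M.eig N f q) = ((freyTrace κ.model S q : ℤ) : k))

/-- **Kraus's refinement at the auxiliary primes, from the trace package (kernel).** Under `FreyTracePackage`, for a standing
datum `S` in case `κ`, a level `N` divisible by the odd part `bs04OddLevel A B C n` of the Serre level (e.g. the Serre level itself,
`bs04OddLevel_dvd_bs04Level`), and a newform `f` with `M.Arises S N f`: the reduction `ψ` takes `c_q(f)` INTO THE KRAUS TABLE
`krausTable κ.model A B C n q` at every odd prime `q ≠ n`, `q ∤ N` — in particular at the auxiliary primes `q ≡ 1 (mod n)` of the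
cell's module M4 and single-exponent rows. (The complementary statement at the remaining primes, `ψ(c_q) ∈ bs04Allowed q`, needs
Hasse's theorem and is `Recipes/FreyTraceLemma42.lean`.) -/
theorem NewformModel.FreyTracePackage.exists_psi_mem_krausTable {M : NewformModel} (hT : M.FreyTracePackage)
    (S : FreyDatum) (κ : FreyCase) (hS : Standing S κ) (N : ℕ) (hdiv : bs04OddLevel S.A S.B S.C S.n ∣ N) (f : M.Form N)
    (hf : M.Arises S N f) :
    ∃ (k : Type) (_ : Field k) (_ : CharP k S.n) (ψ : M.Coeff N f →+* k),
      ∀ q : ℕ, q.Prime → q ≠ 2 → q ≠ S.n → ¬ q ∣ N →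
        (∃ t ∈ krausTable κ.model S.A S.B S.C S.n q, ψ (M.eig N f q) = (t : k)) ∧
        (((q : ℤ) ∣ S.a * S.b →
            ψ (M.eig N f q) = (((q : ℤ) + 1 : ℤ) : k) ∨ ψ (M.eig N f q) = ((-((q : ℤ) + 1) : ℤ) : k)) ∧
          (¬ (q : ℤ) ∣ S.a * S.b → ψ (M.eig N f q) = ((freyTrace κ.model S q : ℤ) : k))) := by
  obtain ⟨k, hk, hchar, ψ, hψ⟩ := hT S κ hS N f hdiv hf
  refine ⟨k, hk, hchar, ψ, fun q hq hq2 hqn hqN => ⟨?_, hψ q hq hq2 hqn hqN⟩⟩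
  obtain ⟨hA, hB, hC, -, -, -, -, -, hsol, -⟩ := hS
  obtain ⟨hmult, hgood⟩ := hψ q hq hq2 hqn hqN
  have hqA : ¬ (q : ℤ) ∣ S.A := by
    intro h
    have h' : q ∣ S.A := by exact_mod_cast h
    exact hqN ((dvd_bs04OddLevel_of_dvd hq hq2 hqn hA hB hC ((h'.mul_right S.B).mul_right S.C)).trans hdiv)
  exact exists_mem_krausTable_of_trace κ.model S hq hsol.1 hqA hmult hgood

end Summit.Ventures.AbcSig
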